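import Literature.Analysis.Calculus.AxisPoincareHomotopy
import HarnessLib

/-!
# The homotopy formula `d(K τ) = τ - h₀* τ` for the linear-homotopy operator on closed 2-forms

Topic `Analysis/Calculus`; namespace `Literature.Analysis.Calculus`.  Theorems only; no named fact,
no `sorry`.  For the operator `K = axisPrimitive P` of `AxisPoincareHomotopy.lean` (contraction onto
`range P` along `h_t = P + t(1 - P)`) and a CLOSED `2`-form `τ` of class `C¹` on an open convex
set `X` with `P(X) ⊆ X`:

  `d(K τ)(y) = τ(y) - (h₀* τ)(y)`,   `(h₀* τ)(y)(v, w) = τ(P y)(P v, P w)`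
                                              (`extDeriv_axisPrimitive_of_closed`).

In particular, when `τ(P y)` vanishes on `(range P)²` — e.g. `P` of rank one —, `K τ` is a
primitive of `τ` on `X` (`extDeriv_axisPrimitive_of_closed_of_apply_base`).  Proof (Bott–Tu 1982,
I §4: `d K + K d = h₁* - h₀*`, here for `dτ = 0`): differentiate under the integral sign
(`hasFDerivAt_axisIntegralA`, `hasFDerivAt_conePrimitive_base`), rewrite the integrand with the
cocycle identity `dτ = 0` (`Dτ(p)(X, q) - Dτ(q)(X, p) = Dτ(X)(p, q)`), and recognise
`d/dt [τ(h_t y)(D h_t v, D h_t w)]`; the fundamental theorem of calculus gives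
`τ(y)(v, w) - τ(P y)(P v, P w)`.

## References

* R. Bott, L. W. Tu, *Differential Forms in Algebraic Topology*, GTM 82 (1982), I §4, §6. [BottTu1982]
* M. Spivak, *Calculus on Manifolds*, Benjamin (1965), Thm. 4-11. [Spivak1965]
-/

noncomputable section

open Set MeasureTheory intervalIntegral Filter Topology
open scoped Interval

namespace Literature.Analysis.Calculus

variable {E F : Type*} [NormedAddCommGroup E] [NormedSpace ℝ E] [NormedAddCommGroup F]
  [NormedSpace ℝ F]

/-! ### Small vector bookkeeping on `Fin 0`, `Fin 1`, `Fin 2` -/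

/-- `(a, L ∘ (b)) = (a, L b)`. [folklore] -/
theorem vecCons_comp_one {α : Type*} (a : α) (L : α → α) (b : α) :
    Matrix.vecCons a (L ∘ ![b]) = ![a, L b] := by
  funext i; refine Fin.cases rfl (fun j ↦ ?_) i; fin_cases j; rfl

/-- `L ∘ (a, b) = (L a, L b)`. [folklore] -/
theorem comp_vecCons_two {α : Type*} (L : α → α) (a b : α) : L ∘ ![a, b] = ![L a, L b] := by
  funext i; fin_cases i <;> rfl

/-- `(a, g) = (a)` for `g : Fin 0 → α`. [folklore] -/
theorem vecCons_fin_zero {α : Type*} (a : α) (g : Fin 0 → α) : Matrix.vecCons a g = ![a] := by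
  rw [Subsingleton.elim g (![] : Fin 0 → α)]

/-- Linearity in the first slot. [folklore] -/
theorem apply_vecCons_add_left (f : E [⋀^Fin 2]→L[ℝ] F) (a b u : E) :
    f ![a + b, u] = f ![a, u] + f ![b, u] := by
  simpa using f.toAlternatingMap.map_vecCons_add ![u] a b

/-- Homogeneity in the first slot. [folklore] -/
theorem apply_vecCons_smul_left (f : E [⋀^Fin 2]→L[ℝ] F) (c : ℝ) (a u : E) :
    f ![c • a, u] = c • f ![a, u] := by
  simpa using f.toAlternatingMap.map_vecCons_smul ![u] c a

/-- **`dω(x)(p, q) = Dω(x)(p)(q) - Dω(x)(q)(p)`** for a `1`-form. [folklore] -/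
theorem extDeriv_one_apply {ω : E → E [⋀^Fin 1]→L[ℝ] F} {x : E}
    {ω' : E →L[ℝ] E [⋀^Fin 1]→L[ℝ] F} (h : HasFDerivAt ω ω' x) (p q : E) :
    extDeriv ω x ![p, q] = ω' p ![q] - ω' q ![p] := by
  rw [extDeriv_apply_vecCons h p ![q], Fin.sum_univ_one]
  simp

/-- **`dτ(x)(p, q, s) = Dτ(p)(q, s) - Dτ(q)(p, s) + Dτ(s)(p, q)`** for a `2`-form. [folklore] -/
theorem extDeriv_two_apply {τ : E → E [⋀^Fin 2]→L[ℝ] F} {x : E}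
    {τ' : E →L[ℝ] E [⋀^Fin 2]→L[ℝ] F} (h : HasFDerivAt τ τ' x) (p q s : E) :
    extDeriv τ x ![p, q, s] = τ' p ![q, s] - τ' q ![p, s] + τ' s ![p, q] := by
  -- `Fin.removeNth` on pairs (the second is `Literature.Geometry.Symplectic.removeNth_one_pair`,
  -- not imported here to keep this file low in the import graph)
  have hr0 : Fin.removeNth 0 ![q, s] = ![s] := by funext i; fin_cases i; rfl
  have hr1 : Fin.removeNth 1 ![q, s] = ![q] := by funext i; fin_cases i; rfl
  rw [extDeriv_apply_vecCons h p ![q, s], Fin.sum_univ_two]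
  simp only [Fin.val_zero, pow_zero, one_smul, Matrix.cons_val_zero, hr0,
    Fin.val_one, pow_one, Matrix.cons_val_one, hr1, neg_smul]
  abel

/-- **The cocycle identity of a closed `2`-form**: `Dτ(p)(X, q) - Dτ(q)(X, p) = Dτ(X)(p, q)` when
`dτ(x) = 0`. [folklore] -/
theorem cocycle_of_extDeriv_eq_zero {τ : E → E [⋀^Fin 2]→L[ℝ] F} {x : E}
    {τ' : E →L[ℝ] E [⋀^Fin 2]→L[ℝ] F} (h : HasFDerivAt τ τ' x) (h0 : extDeriv τ x = 0) (p X q : E) :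
    τ' p ![X, q] - τ' q ![X, p] = τ' X ![p, q] := by
  have h1 := extDeriv_two_apply h p X q
  -- antisymmetry (this is `Literature.Analysis.ODE.twoForm_swap`, not imported here to keep this
  -- file low in the import graph)
  have hsw : τ' q ![p, X] = -τ' q ![X, p] := by
    have h2 := (τ' q).map_swap ![X, p] (i := 0) (j := 1) (by decide)
    have hv : (![X, p] : Fin 2 → E) ∘ Equiv.swap (0 : Fin 2) 1 = ![p, X] := by
      funext i; fin_cases i <;> rfl
    rw [hv] at h2
    exact h2
  rw [h0, ContinuousAlternatingMap.coe_zero, Pi.zero_apply, hsw] at h1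
  -- h1 : 0 = τ' p (X, q) - τ' X (p, q) + -(τ' q (X, p))
  linear_combination (norm := module) -h1

variable [CompleteSpace F]

/-! ### Evaluation commutes with the integral of the derivative integrand -/

/-- `(∫₀¹ F'(y, t, k) dt)(w)(m) = ∫₀¹ F'(y, t, k)(w)(m) dt`. [folklore] -/
theorem integral_axisDerivIntegrand_apply_apply {τ : E → E [⋀^Fin 2]→L[ℝ] F}
    {τ' : E → E →L[ℝ] E [⋀^Fin 2]→L[ℝ] F} {X : Set E} {P : E →L[ℝ] E} {y : E}
    (hstar : StarConvex ℝ (P y) X) (hy : y ∈ X) (hc : ContinuousOn τ X) (hc' : ContinuousOn τ' X)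
    (k : ℕ) (w : E) (m : Fin 1 → E) :
    (∫ t in (0 : ℝ)..1, axisDerivIntegrand P τ τ' y t k) w m =
      ∫ t in (0 : ℝ)..1, axisDerivIntegrand P τ τ' y t k w m := by
  have hint := ContinuousOn.intervalIntegrable (E := E →L[ℝ] E [⋀^Fin 1]→L[ℝ] F) (μ := volume)
    (a := (0 : ℝ)) (b := 1) (u := fun t : ℝ ↦ axisDerivIntegrand P τ τ' y t k)
    (by rw [uIcc_of_le zero_le_one]; exact continuousOn_axisDerivIntegrand hstar hy hc hc' k)
  have h := ContinuousLinearMap.intervalIntegral_comp_comm (𝕜 := ℝ)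
    (E := E →L[ℝ] E [⋀^Fin 1]→L[ℝ] F) (F := F) (μ := volume) (a := (0 : ℝ)) (b := 1)
    (evalCLM (E := E) (F := F) w m) hint
  exact h.symm

/-! ### The homotopy formula -/

set_option maxHeartbeats 3200000 in
/-- **Homotopy formula for the linear-homotopy operator on closed `2`-forms** (Bott–Tu 1982,
I §4, `dK + Kd = h₁* - h₀*` with `dτ = 0`): at a point `y` of an open convex set `X` with
`P(X) ⊆ X`, for `τ` of class `C¹` on `X` (`Dτ = τ'`, both continuous on `X`) and closed on `X`,
granted the local bound of `hasFDerivAt_axisIntegral`,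
`d(K τ)(y)(v, w) = τ(y)(v, w) - τ(P y)(P v, P w)`. [cite: BottTu1982, I §4] -/
theorem extDeriv_axisPrimitive_apply_of_closed {τ : E → E [⋀^Fin 2]→L[ℝ] F}
    {τ' : E → E →L[ℝ] E [⋀^Fin 2]→L[ℝ] F} {X : Set E} {P : E →L[ℝ] E} (hX : Convex ℝ X)
    (hP : ∀ y ∈ X, P y ∈ X) (hd : ∀ x ∈ X, HasFDerivAt τ (τ' x) x) (hc : ContinuousOn τ X)
    (hc' : ContinuousOn τ' X) (hclosed : ∀ x ∈ X, extDeriv τ x = 0) {y : E} {r C : ℝ}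
    (hr : 0 < r) (hball : Metric.ball y r ⊆ X)
    (hC : ∀ y' ∈ Metric.ball y r, ∀ t ∈ Icc (0 : ℝ) 1,
      ‖τ (conePt (P y') y' t)‖ ≤ C ∧ ‖τ' (conePt (P y') y' t)‖ ≤ C) (v w : E) :
    extDeriv (axisPrimitive P τ) y ![v, w] = τ y ![v, w] - τ (P y) ![P v, P w] := by
  have hy : y ∈ X := hball (Metric.mem_ball_self hr)
  have hstar : StarConvex ℝ (P y) X := starConvex_base hX hP hy
  set Q : E →L[ℝ] E := ContinuousLinearMap.id ℝ E - P with hQ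
  have hQv : ∀ u : E, Q u = u - P u := fun u ↦ by simp [hQ]
  -- (1) the derivative of `K τ`
  have hA := hasFDerivAt_axisIntegralA hX hP hd hc hc' hr hball hC
  have hB := hasFDerivAt_conePrimitive_base hX hP hd hc hc' hr hball hC
  set IA := ∫ t in (0 : ℝ)..1, axisDerivIntegrand P τ τ' y t 0 with hIA
  set IB := ∫ t in (0 : ℝ)..1, axisDerivIntegrand P τ τ' y t 1 with hIB
  set LP := ContinuousAlternatingMap.compContinuousLinearMapCLM (ι := Fin 1) (F := F) P with hLP
  set LQ := ContinuousAlternatingMap.compContinuousLinearMapCLM (ι := Fin 1) (F := F) Q with hLQ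
  have hK : HasFDerivAt (axisPrimitive P τ) (LP.comp IA + LQ.comp IB) y := by
    have h1 : HasFDerivAt (fun y' ↦ LP (axisIntegralA P τ y')) (LP.comp IA) y :=
      LP.hasFDerivAt.comp y hA
    have h2 : HasFDerivAt (fun y' ↦ LQ (conePrimitive (P y') τ y')) (LQ.comp IB) y :=
      LQ.hasFDerivAt.comp y hB
    have h3 := h1.add h2
    refine h3.congr_of_eventuallyEq (Eventually.of_forall fun y' ↦ ?_)
    simp only [hLP, hLQ, axisPrimitive, ContinuousAlternatingMap.compContinuousLinearMapCLM_apply, hQ,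
      Pi.add_apply]
  -- (2) the exterior derivative through the integrals
  -- atoms (functions of `t`)
  set pt : ℝ → E := fun t ↦ conePt (P y) y t with hpt
  set Xv : E := y - P y with hXv
  have hptX : ∀ t ∈ Icc (0 : ℝ) 1, pt t ∈ X := fun t ht ↦ conePt_mem hstar hy ht
  -- continuity of the atoms
  have hτc : ∀ m : Fin 2 → E, ContinuousOn (fun t : ℝ ↦ τ (pt t) m) (Icc 0 1) := fun m ↦
    (ContinuousAlternatingMap.apply ℝ E F m).continuous.comp_continuousOn
      (continuousOn_comp_conePt hc hstar hy)
  have hτ'c : ∀ (u : E) (m : Fin 2 → E), ContinuousOn (fun t : ℝ ↦ τ' (pt t) u m) (Icc 0 1) :=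
    fun u m ↦ (ContinuousAlternatingMap.apply ℝ E F m).continuous.comp_continuousOn
      ((continuousOn_comp_conePt hc' hstar hy).clm_apply continuousOn_const)
  -- abbreviations
  set a : E := P v with ha
  set b : E := v - P v with hb
  set c : E := P w with hc0
  set d : E := w - P w with hd0
  have hDv : ∀ t, axisDiff P t v = a + t • b := fun t ↦ by rw [axisDiff_apply]
  have hDw : ∀ t, axisDiff P t w = c + t • d := fun t ↦ by rw [axisDiff_apply]
  -- the integrand of `d(Kτ)(v, w)` after evaluation
  set I2 : ℝ → F := fun t ↦
    (τ (pt t) ![b, c] + τ' (pt t) (a + t • b) ![Xv, c]) +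
      t • (τ (pt t) ![b, d] + τ' (pt t) (a + t • b) ![Xv, d]) -
    ((τ (pt t) ![d, a] + τ' (pt t) (c + t • d) ![Xv, a]) +
      t • (τ (pt t) ![d, b] + τ' (pt t) (c + t • d) ![Xv, b])) with hI2
  -- the derivative of `g t = τ(pt)(a + t b, c + t d)`
  set G : ℝ → F := fun t ↦
    τ' (pt t) Xv ![a, c] + (t • τ' (pt t) Xv ![a, d] + (1 : ℝ) • τ (pt t) ![a, d]) +
      (t • τ' (pt t) Xv ![b, c] + (1 : ℝ) • τ (pt t) ![b, c]) +
      (t ^ 2 • τ' (pt t) Xv ![b, d] + ((2 : ℕ) * t ^ (2 - 1)) • τ (pt t) ![b, d]) with hG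
  -- continuity of `I2` and `G`
  have hI2c : ContinuousOn I2 (Icc 0 1) := by
    have hlin : ∀ (p q : E) (m : Fin 2 → E), ContinuousOn
        (fun t : ℝ ↦ τ' (pt t) (p + t • q) m) (Icc 0 1) := by
      intro p q m
      have : (fun t : ℝ ↦ τ' (pt t) (p + t • q) m) =
          fun t : ℝ ↦ τ' (pt t) p m + t • τ' (pt t) q m := by
        funext t; simp only [map_add, map_smul, ContinuousAlternatingMap.add_apply,
          ContinuousAlternatingMap.smul_apply]
      rw [this]
      exact (hτ'c p m).add (continuousOn_id.smul (hτ'c q m))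
    rw [hI2]
    exact (((hτc _).add (hlin _ _ _)).add (continuousOn_id.smul ((hτc _).add (hlin _ _ _)))).sub
      (((hτc _).add (hlin _ _ _)).add (continuousOn_id.smul ((hτc _).add (hlin _ _ _))))
  have hGc : ContinuousOn G (Icc 0 1) := by
    rw [hG]
    refine ((hτ'c _ _).add ((continuousOn_id.smul (hτ'c _ _)).add
      (continuousOn_const.smul (hτc _)))).add
      ((continuousOn_id.smul (hτ'c _ _)).add (continuousOn_const.smul (hτc _))) |>.add ?_
    exact ((continuousOn_pow 2).smul (hτ'c _ _)).add
      ((continuousOn_const.mul (continuousOn_pow _)).smul (hτc _))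
  have hI2i : IntervalIntegrable I2 volume 0 1 :=
    ContinuousOn.intervalIntegrable (by rw [uIcc_of_le zero_le_one]; exact hI2c)
  have hGi : IntervalIntegrable G volume 0 1 :=
    ContinuousOn.intervalIntegrable (by rw [uIcc_of_le zero_le_one]; exact hGc)
  -- (2a) `d(Kτ)(v, w) = ∫ I2`
  have e1 : extDeriv (axisPrimitive P τ) y ![v, w] = ∫ t in (0 : ℝ)..1, I2 t := by
    rw [extDeriv_one_apply hK v w]
    -- evaluate the derivative
    have hev : ∀ u z : E, (LP.comp IA + LQ.comp IB) u ![z] =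
        (∫ t in (0 : ℝ)..1, axisDerivIntegrand P τ τ' y t 0 u ![P z]) +
          ∫ t in (0 : ℝ)..1, axisDerivIntegrand P τ τ' y t 1 u ![Q z] := by
      intro u z
      rw [FunLike.coe_add, Pi.add_apply, ContinuousAlternatingMap.add_apply,
        ContinuousLinearMap.comp_apply, ContinuousLinearMap.comp_apply, hLP, hLQ,
        ContinuousAlternatingMap.compContinuousLinearMapCLM_apply,
        ContinuousAlternatingMap.compContinuousLinearMapCLM_apply,
        ContinuousAlternatingMap.compContinuousLinearMap_apply,
        ContinuousAlternatingMap.compContinuousLinearMap_apply,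
        integral_axisDerivIntegrand_apply_apply hstar hy hc hc',
        integral_axisDerivIntegrand_apply_apply hstar hy hc hc']
      have h1 : (⇑P ∘ ![z] : Fin 1 → E) = ![P z] := by funext i; fin_cases i; rfl
      have h2 : (⇑Q ∘ ![z] : Fin 1 → E) = ![Q z] := by funext i; fin_cases i; rfl
      rw [h1, h2]
    have hint : ∀ (k : ℕ) (u z : E), IntervalIntegrable
        (fun t : ℝ ↦ axisDerivIntegrand P τ τ' y t k u ![z]) volume 0 1 := by
      intro k u z
      refine ContinuousOn.intervalIntegrable ?_
      rw [uIcc_of_le zero_le_one]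
      exact (ContinuousAlternatingMap.apply ℝ E F ![z]).continuous.comp_continuousOn
        (((continuousOn_axisDerivIntegrand hstar hy hc hc' k)).clm_apply continuousOn_const)
    rw [hev, hev, ← integral_add (hint 0 v (P w)) (hint 1 v (Q w)),
      ← integral_add (hint 0 w (P v)) (hint 1 w (Q v)), ← integral_sub
        ((hint 0 v (P w)).add (hint 1 v (Q w))) ((hint 0 w (P v)).add (hint 1 w (Q v)))]
    refine integral_congr fun t _ ↦ ?_
    simp only [hI2, axisDerivIntegrand_apply_apply, pow_zero, one_smul, pow_one, hQv, hDv, hDw,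
      ha, hb, hc0, hd0, hXv, hpt]
  -- (2b) pointwise `I2 = G` on `[0, 1]` by the cocycle identity and antisymmetry
  have e2 : ∀ t ∈ Icc (0 : ℝ) 1, I2 t = G t := by
    intro t ht
    have hdt : HasFDerivAt τ (τ' (pt t)) (pt t) := hd _ (hptX t ht)
    have h0 : extDeriv τ (pt t) = 0 := hclosed _ (hptX t ht)
    have Rac := cocycle_of_extDeriv_eq_zero hdt h0 a Xv c
    have Rad := cocycle_of_extDeriv_eq_zero hdt h0 a Xv d
    have Rbc := cocycle_of_extDeriv_eq_zero hdt h0 b Xv c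
    have Rbd := cocycle_of_extDeriv_eq_zero hdt h0 b Xv d
    have hsw : ∀ p q : E, τ (pt t) ![q, p] = -τ (pt t) ![p, q] := fun p q ↦ by
      have h2 := (τ (pt t)).map_swap ![p, q] (i := 0) (j := 1) (by decide)
      have hv : (![p, q] : Fin 2 → E) ∘ Equiv.swap (0 : Fin 2) 1 = ![q, p] := by
        funext i; fin_cases i <;> rfl
      rw [hv] at h2
      exact h2
    have Sda := hsw a d
    have Sdb := hsw b d
    simp only [hI2, hG, map_add, map_smul, ContinuousAlternatingMap.add_apply,
      ContinuousAlternatingMap.smul_apply]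
    rw [Sda, Sdb]
    simp only [one_smul, Nat.cast_ofNat, show (2 : ℕ) - 1 = 1 from rfl, pow_one]
    linear_combination (norm := module) Rac + t • Rad + t • Rbc + (t ^ 2) • Rbd
  -- (2c) `∫₀¹ G = g(1) - g(0)` by the fundamental theorem of calculus
  have e3 : ∫ t in (0 : ℝ)..1, G t = τ y ![v, w] - τ (P y) ![a, c] := by
    have hderiv : ∀ t ∈ uIcc (0 : ℝ) 1, HasDerivAt
        (fun s : ℝ ↦ τ (pt s) ![a, c] + s • τ (pt s) ![a, d] + s • τ (pt s) ![b, c] +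
          s ^ 2 • τ (pt s) ![b, d]) (G t) t := by
      intro t ht
      rw [uIcc_of_le zero_le_one] at ht
      have hdt : HasFDerivAt τ (τ' (conePt (P y) y t)) (conePt (P y) y t) := hd _ (hptX t ht)
      have hat : ∀ m : Fin 2 → E, HasDerivAt (fun s : ℝ ↦ τ (pt s) m) (τ' (pt t) Xv m) t :=
        fun m ↦ hasDerivAt_apply_conePt hdt m
      have h1 := hat ![a, c]
      have h2 := (hasDerivAt_id' t).fun_smul (hat ![a, d])
      have h3 := (hasDerivAt_id' t).fun_smul (hat ![b, c])
      have h4 := (hasDerivAt_pow 2 t).fun_smul (hat ![b, d])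
      exact ((h1.fun_add h2).fun_add h3).fun_add h4
    have hval : ∀ s : ℝ, τ (pt s) ![a, c] + s • τ (pt s) ![a, d] + s • τ (pt s) ![b, c] +
        s ^ 2 • τ (pt s) ![b, d] = τ (pt s) ![a + s • b, c + s • d] := by
      intro s
      rw [apply_vecCons_add_left, apply_vecCons_add, apply_vecCons_add, apply_vecCons_smul,
        apply_vecCons_smul, apply_vecCons_smul_left, apply_vecCons_smul_left, smul_smul, ← pow_two]
      abel
    rw [integral_eq_sub_of_hasDerivAt hderiv hGi, hval, hval]
    have hv1 : a + (1 : ℝ) • b = v := by rw [ha, hb, one_smul, add_sub_cancel]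
    have hw1 : c + (1 : ℝ) • d = w := by rw [hc0, hd0, one_smul, add_sub_cancel]
    simp only [hpt, conePt_one, conePt_zero, hv1, hw1, zero_smul, add_zero]
  -- (3) assemble
  rw [e1, integral_congr (fun t ht ↦ e2 t (by rwa [uIcc_of_le zero_le_one] at ht)), e3]

/-- **`d(K τ) = τ - h₀* τ`** as an identity of `2`-forms:
`extDeriv (K τ) y = τ y - (τ (P y)) ∘ P`. [cite: BottTu1982, I §4] -/
theorem extDeriv_axisPrimitive_of_closed {τ : E → E [⋀^Fin 2]→L[ℝ] F}
    {τ' : E → E →L[ℝ] E [⋀^Fin 2]→L[ℝ] F} {X : Set E} {P : E →L[ℝ] E} (hX : Convex ℝ X)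
    (hP : ∀ y ∈ X, P y ∈ X) (hd : ∀ x ∈ X, HasFDerivAt τ (τ' x) x) (hc : ContinuousOn τ X)
    (hc' : ContinuousOn τ' X) (hclosed : ∀ x ∈ X, extDeriv τ x = 0) {y : E} {r C : ℝ}
    (hr : 0 < r) (hball : Metric.ball y r ⊆ X)
    (hC : ∀ y' ∈ Metric.ball y r, ∀ t ∈ Icc (0 : ℝ) 1,
      ‖τ (conePt (P y') y' t)‖ ≤ C ∧ ‖τ' (conePt (P y') y' t)‖ ≤ C) :
    extDeriv (axisPrimitive P τ) y = τ y - (τ (P y)).compContinuousLinearMap P := by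
  ext m
  have hm : m = ![m 0, m 1] := by funext i; fin_cases i <;> rfl
  rw [hm, extDeriv_axisPrimitive_apply_of_closed hX hP hd hc hc' hclosed hr hball hC,
    ContinuousAlternatingMap.sub_apply, ContinuousAlternatingMap.compContinuousLinearMap_apply,
    comp_vecCons_two]

/-- **The relative Poincaré lemma along the axis**: if moreover `τ(P y)` vanishes on pairs of
vectors of `range P` (e.g. `P` has rank `≤ 1`), then `K τ` is a primitive of `τ`:
`d(K τ)(y) = τ(y)`. [cite: BottTu1982, I §6] -/
theorem extDeriv_axisPrimitive_of_closed_of_apply_base {τ : E → E [⋀^Fin 2]→L[ℝ] F}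
    {τ' : E → E →L[ℝ] E [⋀^Fin 2]→L[ℝ] F} {X : Set E} {P : E →L[ℝ] E} (hX : Convex ℝ X)
    (hP : ∀ y ∈ X, P y ∈ X) (hd : ∀ x ∈ X, HasFDerivAt τ (τ' x) x) (hc : ContinuousOn τ X)
    (hc' : ContinuousOn τ' X) (hclosed : ∀ x ∈ X, extDeriv τ x = 0) {y : E} {r C : ℝ}
    (hr : 0 < r) (hball : Metric.ball y r ⊆ X)
    (hC : ∀ y' ∈ Metric.ball y r, ∀ t ∈ Icc (0 : ℝ) 1,
      ‖τ (conePt (P y') y' t)‖ ≤ C ∧ ‖τ' (conePt (P y') y' t)‖ ≤ C)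
    (h0 : ∀ v w : E, τ (P y) ![P v, P w] = 0) :
    extDeriv (axisPrimitive P τ) y = τ y := by
  ext m
  have hm : m = ![m 0, m 1] := by funext i; fin_cases i <;> rfl
  rw [hm, extDeriv_axisPrimitive_apply_of_closed hX hP hd hc hc' hclosed hr hball hC, h0, sub_zero]

end Literature.Analysis.Calculus

end
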